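import Literature.Analysis.FluidPDE.ConfinedHardSphereFlowEvents
import Literature.Analysis.FluidPDE.ConfinedHardSphereFlowDefs
import HarnessLib

/-!
# Orbits of the event-by-event confined flow are confined hard-sphere trajectories

Third layer of the proof of `ConfinedHardSphereFlow.nonempty_torus_balls` (existence of the
confined hard-sphere flow on the torus among fixed round scatterers; Cercignani–Illner–Pulvirenti
1994 §4.2 p. 65 and Thm. 4.2.1, App. 4.A p. 111): for the construction `ConfinedAlexander.flow`
of `ConfinedHardSphereFlowConstruction` with good set `ConfinedAlexander.good`, *orbits of good
points are confined hard-sphere trajectories* (`IsConfinedHardSphereTrajectory`: free flight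
between locally finitely many events, each a single binary non-grazing collision or a single
specular reflection of one sphere at one scatterer, from an incoming left limit), in every
geometry regular at the sphere diameter `ε` and at the exclusion radius `ρ` of the scatterers
(`Geometry.IsHardSphereRegular`). This is the analogue, line by line, of
`Literature.Analysis.FluidPDE.HardSphereFlowOrbits` (the wall-free case), whose pair bookkeeping
it reuses.

Contents (namespace `ConfinedAlexander`): segments of the forward flow (`eventCount_eq_of_segment`,
`fwdFlow_eq_of_segment`, …, any datum); the forward orbit of a forward-good datum (states stay
confined, instants strictly increase and do not accumulate, `instantSet`, the jump relation
`Φ_t = eventJump Φ_{t⁻}` with `Φ_{t⁻}` a simple event configuration, contacts of either kind only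
at instants, free flight between instants, local finiteness, the four one-sided limits); the
two-sided orbit of a good datum (event times, limits, continuity of positions, free flight on
event-free windows, the binary-collision clause and the wall clause), assembled into
`isConfinedHardSphereTrajectory_flow`.

## References

* C. Cercignani, R. Illner, M. Pulvirenti, *The Mathematical Theory of Dilute Gases*, Springer
  (1994), §4.2 p. 65 (the flow `T^t` on `Γ₀`), eq. (2.3), Thm. 4.2.1, Appendix 4.A pp. 107–111.
* R. K. Alexander, *The infinite hard sphere system*, PhD thesis, UC Berkeley (1975).
* I. Gallagher, L. Saint-Raymond, B. Texier, *From Newton to Boltzmann* (2013), §4.1.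
-/

open Set Filter Function
open scoped ENNReal Topology InnerProductSpace

namespace Literature.Analysis.FluidPDE

noncomputable section

section Kinetic

variable {d : Type*} [Fintype d] {X : Type*} {N : ℕ} {ι : Type*}

namespace ConfinedAlexander

variable {G : Geometry d X} {W : ι → Wall d X} {ε : ℝ} {ctr : ι → X} {ρ : ℝ} {hρ : 0 < ρ}

/-! ## Counting events: segments of the forward flow (no hypotheses on the datum) -/

section Count

variable {y : Config N d X}

/-- If `t_k ≤ u < t_{k+1}` then `k` events are counted in `[0, u]`. [folklore] -/
theorem eventCount_eq_of_segment {u : ℝ} {k : ℕ} (h1 : eventInstant G W ε y k ≤ ENNReal.ofReal u)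
    (h2 : ENNReal.ofReal u < eventInstant G W ε y (k + 1)) : eventCount G W ε y u = k := by
  have hub : ∀ m ∈ {m : ℕ | eventInstant G W ε y m ≤ ENNReal.ofReal u}, m ≤ k := by
    intro m hm
    by_contra hmk
    exact (not_le.2 h2) ((monotone_eventInstant y (Nat.succ_le_of_lt (not_le.1 hmk))).trans hm)
  exact le_antisymm (csSup_le' hub) (le_csSup ⟨k, hub⟩ h1)

/-- If `t_k < u ≤ t_{k+1}` (or `k = 0` and `u ≤ t_1`) then `k` events are counted in `[0, u)`. [folklore] -/
theorem eventCountBefore_eq_of_segment {u : ℝ} {k : ℕ}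
    (h1 : eventInstant G W ε y k < ENNReal.ofReal u ∨ k = 0)
    (h2 : ENNReal.ofReal u ≤ eventInstant G W ε y (k + 1)) : eventCountBefore G W ε y u = k := by
  have hub : ∀ m ∈ {m : ℕ | eventInstant G W ε y m < ENNReal.ofReal u}, m ≤ k := by
    intro m hm
    by_contra hmk
    exact (not_lt.2 h2) ((monotone_eventInstant y (Nat.succ_le_of_lt (not_le.1 hmk))).trans_lt hm)
  refine le_antisymm (csSup_le' hub) ?_
  rcases h1 with h1 | rfl
  · exact le_csSup ⟨k, hub⟩ h1
  · exact Nat.zero_le _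

/-- On the segment `t_k ≤ u < t_{k+1}` the forward flow is `S_{u - t_k} z_k`. [folklore] -/
theorem fwdFlow_eq_of_segment {u : ℝ} {k : ℕ} (h1 : eventInstant G W ε y k ≤ ENNReal.ofReal u)
    (h2 : ENNReal.ofReal u < eventInstant G W ε y (k + 1)) :
    fwdFlow G W ε y u = freeFlight G (u - (eventInstant G W ε y k).toReal) (stateAfter G W ε y k) := by
  rw [fwdFlow, eventCount_eq_of_segment h1 h2]

/-- On the segment `t_k < u ≤ t_{k+1}` (or `k = 0`, `u ≤ t_1`) the left-continuous forward flow is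
`S_{u - t_k} z_k`. [folklore] -/
theorem fwdFlowLeft_eq_of_segment {u : ℝ} {k : ℕ}
    (h1 : eventInstant G W ε y k < ENNReal.ofReal u ∨ k = 0)
    (h2 : ENNReal.ofReal u ≤ eventInstant G W ε y (k + 1)) :
    fwdFlowLeft G W ε y u =
      freeFlight G (u - (eventInstant G W ε y k).toReal) (stateAfter G W ε y k) := by
  rw [fwdFlowLeft, eventCountBefore_eq_of_segment h1 h2]

end Count

/-! ## Forward-good data: states, instants and segments -/

namespace FwdGood

variable {y : Config N d X}

/-- On a forward-good orbit each finite free flight ends in a simple event configuration, and the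
next state is the resolution of that event. [folklore] -/
theorem stateAfter_succ_eq (hgood : FwdGood G W ε y) {k : ℕ}
    (hk : exitTime G W ε (stateAfter G W ε y k) ≠ ∞) :
    IsSimpleEvent G W ε
        (freeFlight G (exitTime G W ε (stateAfter G W ε y k)).toReal (stateAfter G W ε y k)) ∧
      stateAfter G W ε y (k + 1) =
        eventJump G W ε (freeFlight G (exitTime G W ε (stateAfter G W ε y k)).toReal
          (stateAfter G W ε y k)) :=
  ⟨hgood.1 k hk, by rw [stateAfter_succ, eventStep_of_ne_top hk]⟩

/-- The event instants of a forward-good orbit do not accumulate: they exceed every finite bound. [folklore] -/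
theorem exists_lt_eventInstant (hgood : FwdGood G W ε y) {c : ℝ≥0∞} (hc : c ≠ ∞) :
    ∃ k, c < eventInstant G W ε y k := by
  have ht : Tendsto (eventInstant G W ε y) atTop (𝓝 ∞) := by
    have h := ENNReal.tendsto_nat_tsum fun m => exitTime G W ε (stateAfter G W ε y m)
    rwa [hgood.2.2] at h
  exact (ht.eventually (lt_mem_nhds hc.lt_top)).exists

/-- Every time `u` lies in a segment `[t_k, t_{k+1})` of a forward-good orbit. [folklore] -/
theorem exists_segment (hgood : FwdGood G W ε y) (u : ℝ) :
    ∃ k, eventInstant G W ε y k ≤ ENNReal.ofReal u ∧ ENNReal.ofReal u < eventInstant G W ε y (k + 1) := by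
  classical
  have hex : ∃ k, ENNReal.ofReal u < eventInstant G W ε y k :=
    hgood.exists_lt_eventInstant ENNReal.ofReal_ne_top
  have hK := Nat.find_spec hex
  have hK0 : Nat.find hex ≠ 0 := by
    intro h0
    rw [h0, eventInstant_zero] at hK
    exact ENNReal.not_lt_zero hK
  obtain ⟨k, hk⟩ := Nat.exists_eq_succ_of_ne_zero hK0
  rw [hk] at hK
  exact ⟨k, not_lt.1 (Nat.find_min hex (by omega)), hK⟩

/-- Every positive time `u` lies in a segment `(t_k, t_{k+1}]` of a forward-good orbit. [folklore] -/
theorem exists_segment_left (hgood : FwdGood G W ε y) {u : ℝ} (hu : 0 < u) :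
    ∃ k, eventInstant G W ε y k < ENNReal.ofReal u ∧ ENNReal.ofReal u ≤ eventInstant G W ε y (k + 1) := by
  classical
  have hex : ∃ k, ENNReal.ofReal u ≤ eventInstant G W ε y k := by
    obtain ⟨k, hk⟩ := hgood.exists_lt_eventInstant (c := ENNReal.ofReal u) ENNReal.ofReal_ne_top
    exact ⟨k, hk.le⟩
  have hK := Nat.find_spec hex
  have hK0 : Nat.find hex ≠ 0 := by
    intro h0
    rw [h0, eventInstant_zero, nonpos_iff_eq_zero, ENNReal.ofReal_eq_zero] at hK
    exact (not_le.2 hu) hK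
  obtain ⟨k, hk⟩ := Nat.exists_eq_succ_of_ne_zero hK0
  rw [hk] at hK
  exact ⟨k, not_le.1 (Nat.find_min hex (by omega)), hK⟩

/-- All states of a forward-good orbit started in the confined domain are confined (each segment
stays confined before its exit time, and for a finite exit time the exit configuration is the
limit of confined ones — here obtained without topology from the next segment when it has
positive length, and in general from the structure of simple events: contact sets lie in the
hard-sphere domain and … ); we give the topology-free statement that is actually needed: the
state reached after a FINITE exit time has the positions of the exit configuration. [folklore] -/
theorem stateAfter_succ_apply_fst (hgood : FwdGood G W ε y) {k : ℕ}
    (hk : exitTime G W ε (stateAfter G W ε y k) ≠ ∞) (i : Fin N) :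
    (stateAfter G W ε y (k + 1) i).1 =
      (freeFlight G (exitTime G W ε (stateAfter G W ε y k)).toReal (stateAfter G W ε y k) i).1 := by
  rw [(hgood.stateAfter_succ_eq hk).2, eventJump_apply_fst]

section Regular

variable [TopologicalSpace X] [Finite ι]

omit [Finite ι] in
/-- All states of a forward-good orbit started in the confined domain are confined (round
scatterers, regular geometry: the exit configuration of a confined datum is confined, and the
event resolution does not move spheres). [folklore] -/
theorem stateAfter_mem (hG : G.IsHardSphereRegular ε) (hGρ : G.IsHardSphereRegular ρ)
    {y : Config N d X} (hy : y ∈ confinedDomain G (Wall.balls G ctr ρ hρ) N ε)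
    (hgood : FwdGood G (Wall.balls G ctr ρ hρ) ε y) (k : ℕ) :
    stateAfter G (Wall.balls G ctr ρ hρ) ε y k ∈ confinedDomain G (Wall.balls G ctr ρ hρ) N ε := by
  induction k with
  | zero => exact hy
  | succ k ih =>
    by_cases hk : exitTime G (Wall.balls G ctr ρ hρ) ε (stateAfter G (Wall.balls G ctr ρ hρ) ε y k) = ∞
    · rw [stateAfter_succ, eventStep_of_eq_top hk]
      exact ih
    · rw [(hgood.stateAfter_succ_eq hk).2, eventJump_mem_confinedDomain_iff]
      exact freeFlight_exitTime_mem hG hGρ ih hk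

/-- On a forward-good orbit of a regular geometry every post-event state has a positive exit
time: events do not happen at the same instant. [folklore] -/
theorem exitTime_stateAfter_succ_pos (hG : G.IsHardSphereRegular ε) (hGρ : G.IsHardSphereRegular ρ)
    {y : Config N d X} (hy : y ∈ confinedDomain G (Wall.balls G ctr ρ hρ) N ε)
    (hgood : FwdGood G (Wall.balls G ctr ρ hρ) ε y) (k : ℕ) :
    0 < exitTime G (Wall.balls G ctr ρ hρ) ε (stateAfter G (Wall.balls G ctr ρ hρ) ε y (k + 1)) := by
  by_cases hk : exitTime G (Wall.balls G ctr ρ hρ) ε (stateAfter G (Wall.balls G ctr ρ hρ) ε y k) = ∞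
  · rw [stateAfter_succ, eventStep_of_eq_top hk, hk]
    exact ENNReal.zero_lt_top
  · obtain ⟨hev, heq⟩ := hgood.stateAfter_succ_eq hk
    rw [heq]
    exact hev.exitTime_eventJump_pos hG hGρ (freeFlight_exitTime_mem hG hGρ (hgood.stateAfter_mem hG hGρ hy k) hk)

/-- The finite event instants of positive index are strictly increasing. [folklore] -/
theorem eventInstant_lt_succ (hG : G.IsHardSphereRegular ε) (hGρ : G.IsHardSphereRegular ρ)
    {y : Config N d X} (hy : y ∈ confinedDomain G (Wall.balls G ctr ρ hρ) N ε)
    (hgood : FwdGood G (Wall.balls G ctr ρ hρ) ε y) {k : ℕ} (hk : 0 < k)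
    (hfin : eventInstant G (Wall.balls G ctr ρ hρ) ε y k ≠ ∞) :
    eventInstant G (Wall.balls G ctr ρ hρ) ε y k < eventInstant G (Wall.balls G ctr ρ hρ) ε y (k + 1) := by
  rw [eventInstant_succ]
  obtain ⟨m, rfl⟩ := Nat.exists_eq_succ_of_ne_zero hk.ne'
  exact ENNReal.lt_add_right hfin (hgood.exitTime_stateAfter_succ_pos hG hGρ hy m).ne'

/-- `t_k < t_{k+1}` as soon as `t_k` is finite and either `k > 0` or `τ(y) > 0`. [folklore] -/
theorem eventInstant_lt_succ' (hG : G.IsHardSphereRegular ε) (hGρ : G.IsHardSphereRegular ρ)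
    {y : Config N d X} (hy : y ∈ confinedDomain G (Wall.balls G ctr ρ hρ) N ε)
    (hgood : FwdGood G (Wall.balls G ctr ρ hρ) ε y) {k : ℕ}
    (hk : 0 < k ∨ 0 < exitTime G (Wall.balls G ctr ρ hρ) ε y)
    (hfin : eventInstant G (Wall.balls G ctr ρ hρ) ε y k ≠ ∞) :
    eventInstant G (Wall.balls G ctr ρ hρ) ε y k < eventInstant G (Wall.balls G ctr ρ hρ) ε y (k + 1) := by
  rcases Nat.eq_zero_or_pos k with rfl | hpos
  · have h0 : 0 < exitTime G (Wall.balls G ctr ρ hρ) ε y := hk.resolve_left (lt_irrefl 0)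
    simpa using h0
  · exact hgood.eventInstant_lt_succ hG hGρ hy hpos hfin

/-- The forward flow at a finite event instant `t_k` is the post-event state `z_k`
(right-continuity convention), provided `k > 0` or `τ(y) > 0`. [folklore] -/
theorem fwdFlow_eventInstant (hG : G.IsHardSphereRegular ε) (hGρ : G.IsHardSphereRegular ρ)
    {y : Config N d X} (hy : y ∈ confinedDomain G (Wall.balls G ctr ρ hρ) N ε)
    (hgood : FwdGood G (Wall.balls G ctr ρ hρ) ε y) {k : ℕ}
    (hfin : eventInstant G (Wall.balls G ctr ρ hρ) ε y k ≠ ∞)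
    (hk : 0 < k ∨ 0 < exitTime G (Wall.balls G ctr ρ hρ) ε y) :
    fwdFlow G (Wall.balls G ctr ρ hρ) ε y (eventInstant G (Wall.balls G ctr ρ hρ) ε y k).toReal =
      stateAfter G (Wall.balls G ctr ρ hρ) ε y k := by
  rw [fwdFlow_eq_of_segment (k := k) (by rw [ENNReal.ofReal_toReal hfin])
    (by rw [ENNReal.ofReal_toReal hfin]; exact hgood.eventInstant_lt_succ' hG hGρ hy hk hfin),
    sub_self, freeFlight_zero]

/-- The left-continuous forward flow at a finite event instant `t_{k+1}` is the pre-event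
configuration `S_{τ(z_k)} z_k`. [folklore] -/
theorem fwdFlowLeft_eventInstant_succ (hG : G.IsHardSphereRegular ε) (hGρ : G.IsHardSphereRegular ρ)
    {y : Config N d X} (hy : y ∈ confinedDomain G (Wall.balls G ctr ρ hρ) N ε)
    (hgood : FwdGood G (Wall.balls G ctr ρ hρ) ε y) {k : ℕ}
    (hfin : eventInstant G (Wall.balls G ctr ρ hρ) ε y (k + 1) ≠ ∞) :
    fwdFlowLeft G (Wall.balls G ctr ρ hρ) ε y (eventInstant G (Wall.balls G ctr ρ hρ) ε y (k + 1)).toReal =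
      freeFlight G (exitTime G (Wall.balls G ctr ρ hρ) ε (stateAfter G (Wall.balls G ctr ρ hρ) ε y k)).toReal
        (stateAfter G (Wall.balls G ctr ρ hρ) ε y k) := by
  have hfin' : eventInstant G (Wall.balls G ctr ρ hρ) ε y k ≠ ∞ ∧
      exitTime G (Wall.balls G ctr ρ hρ) ε (stateAfter G (Wall.balls G ctr ρ hρ) ε y k) ≠ ∞ := by
    rwa [eventInstant_succ, ENNReal.add_ne_top] at hfin
  rw [fwdFlowLeft_eq_of_segment (k := k) ?_ (by rw [ENNReal.ofReal_toReal hfin])]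
  · rw [eventInstant_succ, ENNReal.toReal_add hfin'.1 hfin'.2, add_sub_cancel_left]
  · rcases Nat.eq_zero_or_pos k with rfl | hk
    · exact Or.inr rfl
    · left
      rw [ENNReal.ofReal_toReal hfin]
      exact hgood.eventInstant_lt_succ hG hGρ hy hk hfin'.1

end Regular

end FwdGood

/-! ## The event instants as a set of real times -/

/-- A finite instant of positive index belongs to `instantSet`. [folklore] -/
theorem toReal_eventInstant_mem_instantSet {y : Config N d X} {k : ℕ} (hk : 0 < k)
    (hfin : eventInstant G W ε y k ≠ ∞) : (eventInstant G W ε y k).toReal ∈ instantSet G W ε y :=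
  ⟨ENNReal.toReal_nonneg, k, hk, (ENNReal.ofReal_toReal hfin).symm⟩

namespace FwdGood

variable {y : Config N d X}

/-- The forward flow of a forward-good datum stays in the confined domain. [folklore] -/
theorem fwdFlow_mem (hgood : FwdGood G W ε y) {u : ℝ} (hu : 0 ≤ u) :
    fwdFlow G W ε y u ∈ confinedDomain G W N ε := by
  obtain ⟨k, h1, h2⟩ := hgood.exists_segment u
  rw [fwdFlow_eq_of_segment h1 h2]
  refine freeFlight_mem_confinedDomain_of_lt (sub_nonneg.2 (ENNReal.toReal_le_of_le_ofReal hu h1)) ?_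
  rw [eventInstant_succ] at h2
  exact Alexander.ofReal_sub_toReal_lt hu h1 h2

/-- **Pair contacts happen only at instants** (right-continuous flow). [folklore] -/
theorem mem_instantSet_of_fwdFlow_mem_contactSet (hgood : FwdGood G W ε y) {u : ℝ} (hu : 0 < u)
    {i j : Fin N} (hij : i ≠ j) (hc : fwdFlow G W ε y u ∈ contactSet G N ε i j) :
    u ∈ instantSet G W ε y := by
  obtain ⟨k, h1, h2⟩ := hgood.exists_segment u
  rcases h1.lt_or_eq with hlt | heq
  · exfalso
    rw [fwdFlow_eq_of_segment h1 h2] at hc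
    refine (hgood.2.1 k _ (sub_pos.2 (ENNReal.toReal_lt_of_lt_ofReal hlt)) ?_).1 i j hij hc
    rw [eventInstant_succ] at h2
    exact Alexander.ofReal_sub_toReal_lt hu.le h1 h2
  · refine ⟨hu.le, k, Nat.pos_of_ne_zero ?_, heq⟩
    rintro rfl
    rw [eventInstant_zero] at heq
    exact (ENNReal.ofReal_pos.2 hu).ne heq

/-- **Wall contacts happen only at instants** (right-continuous flow). [folklore] -/
theorem mem_instantSet_of_fwdFlow_mem_contact (hgood : FwdGood G W ε y) {u : ℝ} (hu : 0 < u)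
    {i : Fin N} {k' : ι} (hc : (fwdFlow G W ε y u i).1 ∈ (W k').contact) : u ∈ instantSet G W ε y := by
  obtain ⟨k, h1, h2⟩ := hgood.exists_segment u
  rcases h1.lt_or_eq with hlt | heq
  · exfalso
    rw [fwdFlow_eq_of_segment h1 h2] at hc
    refine (hgood.2.1 k _ (sub_pos.2 (ENNReal.toReal_lt_of_lt_ofReal hlt)) ?_).2 i k' hc
    rw [eventInstant_succ] at h2
    exact Alexander.ofReal_sub_toReal_lt hu.le h1 h2
  · refine ⟨hu.le, k, Nat.pos_of_ne_zero ?_, heq⟩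
    rintro rfl
    rw [eventInstant_zero] at heq
    exact (ENNReal.ofReal_pos.2 hu).ne heq

/-- **Free flight between instants** (right-continuous flow): if `(a, b]` contains no instant
then `Φ_b = S_{b-a} Φ_a`. [folklore] -/
theorem fwdFlow_eq_freeFlight_fwdFlow (hgood : FwdGood G W ε y) {a b : ℝ} (ha : 0 ≤ a) (hab : a ≤ b)
    (hfree : ∀ u ∈ instantSet G W ε y, u ∉ Ioc a b) :
    fwdFlow G W ε y b = freeFlight G (b - a) (fwdFlow G W ε y a) := by
  obtain ⟨k, h1, h2⟩ := hgood.exists_segment a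
  have h2b : ENNReal.ofReal b < eventInstant G W ε y (k + 1) := by
    by_contra hle
    rw [not_lt] at hle
    have hfin : eventInstant G W ε y (k + 1) ≠ ∞ := ne_top_of_le_ne_top ENNReal.ofReal_ne_top hle
    refine hfree _ (toReal_eventInstant_mem_instantSet (Nat.succ_pos k) hfin) ⟨?_, ?_⟩
    · exact (ENNReal.ofReal_lt_iff_lt_toReal ha hfin).1 h2
    · exact ENNReal.toReal_le_of_le_ofReal (ha.trans hab) hle
  rw [fwdFlow_eq_of_segment h1 h2, fwdFlow_eq_of_segment (h1.trans (ENNReal.ofReal_le_ofReal hab)) h2b,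
    ← freeFlight_add]
  congr 1
  ring

/-- **Free flight between instants** (left-continuous flow): if `[a, b)` contains no instant
then `Φ_{b⁻} = S_{b-a} Φ_{a⁻}`. [folklore] -/
theorem fwdFlowLeft_eq_freeFlight_fwdFlowLeft (hgood : FwdGood G W ε y) {a b : ℝ} (ha : 0 ≤ a)
    (hab : a ≤ b) (hfree : ∀ u ∈ instantSet G W ε y, u ∉ Ico a b) :
    fwdFlowLeft G W ε y b = freeFlight G (b - a) (fwdFlowLeft G W ε y a) := by
  rcases hab.eq_or_lt with rfl | hab'
  · simp
  have hb : 0 < b := ha.trans_lt hab'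
  obtain ⟨k, h1, h2⟩ := hgood.exists_segment_left hb
  have hka : eventInstant G W ε y k < ENNReal.ofReal a ∨ k = 0 := by
    rcases Nat.eq_zero_or_pos k with rfl | hk
    · exact Or.inr rfl
    · left
      by_contra hle
      rw [not_lt] at hle
      have hfin : eventInstant G W ε y k ≠ ∞ := ne_top_of_lt h1
      refine hfree _ (toReal_eventInstant_mem_instantSet hk hfin) ⟨?_, ?_⟩
      · exact (ENNReal.ofReal_le_iff_le_toReal hfin).1 hle
      · exact ENNReal.toReal_lt_of_lt_ofReal h1
  rw [fwdFlowLeft_eq_of_segment (Or.inl h1) h2,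
    fwdFlowLeft_eq_of_segment hka ((ENNReal.ofReal_le_ofReal hab).trans h2), ← freeFlight_add]
  congr 1
  ring

/-- The instants of a forward-good orbit are locally finite. [folklore] -/
theorem finite_instantSet_inter_Iic (hgood : FwdGood G W ε y) (b : ℝ) :
    (instantSet G W ε y ∩ Iic b).Finite := by
  obtain ⟨K, hK⟩ := hgood.exists_lt_eventInstant (c := ENNReal.ofReal b) ENNReal.ofReal_ne_top
  refine ((Finset.range K).finite_toSet.image fun k => (eventInstant G W ε y k).toReal).subset ?_
  rintro u ⟨⟨hu0, k, -, hTk⟩, hub⟩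
  refine ⟨k, ?_, ?_⟩
  · rw [Finset.coe_range, mem_Iio]
    by_contra hkK
    have hmono := monotone_eventInstant (G := G) (W := W) (ε := ε) y (not_lt.1 hkK)
    rw [hTk] at hmono
    exact (lt_irrefl _) ((hK.trans_le hmono).trans_le (ENNReal.ofReal_le_ofReal hub))
  · change (eventInstant G W ε y k).toReal = u
    rw [hTk, ENNReal.toReal_ofReal hu0]

section Regular

variable [TopologicalSpace X] [Finite ι] {y : Config N d X}

/-- **The jump at an event instant**: at `u ∈ instantSet`, the left-continuous forward flow is a
simple event configuration and the forward flow is the resolution of that event. [folklore] -/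
theorem exists_jump (hG : G.IsHardSphereRegular ε) (hGρ : G.IsHardSphereRegular ρ)
    (hy : y ∈ confinedDomain G (Wall.balls G ctr ρ hρ) N ε)
    (hgood : FwdGood G (Wall.balls G ctr ρ hρ) ε y) {u : ℝ}
    (hu : u ∈ instantSet G (Wall.balls G ctr ρ hρ) ε y) :
    IsSimpleEvent G (Wall.balls G ctr ρ hρ) ε (fwdFlowLeft G (Wall.balls G ctr ρ hρ) ε y u) ∧
      fwdFlow G (Wall.balls G ctr ρ hρ) ε y u =
        eventJump G (Wall.balls G ctr ρ hρ) ε (fwdFlowLeft G (Wall.balls G ctr ρ hρ) ε y u) := by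
  set W := Wall.balls G ctr ρ hρ
  obtain ⟨hu0, k, hk, hTk⟩ := hu
  obtain ⟨m, rfl⟩ := Nat.exists_eq_succ_of_ne_zero hk.ne'
  have hfin : eventInstant G W ε y (m + 1) ≠ ∞ := by rw [hTk]; exact ENNReal.ofReal_ne_top
  have hu' : u = (eventInstant G W ε y (m + 1)).toReal := by rw [hTk, ENNReal.toReal_ofReal hu0]
  have hτ : exitTime G W ε (stateAfter G W ε y m) ≠ ∞ := by
    have h := hfin
    rw [eventInstant_succ, ENNReal.add_ne_top] at h
    exact h.2
  obtain ⟨hev, heq⟩ := hgood.stateAfter_succ_eq hτ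
  refine ⟨?_, ?_⟩
  · rw [hu', hgood.fwdFlowLeft_eventInstant_succ hG hGρ hy hfin]
    exact hev
  · rw [hu', hgood.fwdFlowLeft_eventInstant_succ hG hGρ hy hfin,
      hgood.fwdFlow_eventInstant hG hGρ hy hfin (Or.inl (Nat.succ_pos m)), heq]

/-- The left-continuous and the right-continuous forward flows have the same positions (events
do not move spheres). [folklore] -/
theorem fwdFlowLeft_apply_fst (hG : G.IsHardSphereRegular ε) (hGρ : G.IsHardSphereRegular ρ)
    (hy : y ∈ confinedDomain G (Wall.balls G ctr ρ hρ) N ε)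
    (hgood : FwdGood G (Wall.balls G ctr ρ hρ) ε y) {u : ℝ} (hu : 0 ≤ u) (i : Fin N) :
    (fwdFlowLeft G (Wall.balls G ctr ρ hρ) ε y u i).1 = (fwdFlow G (Wall.balls G ctr ρ hρ) ε y u i).1 := by
  set W := Wall.balls G ctr ρ hρ
  obtain ⟨k, h1, h2⟩ := hgood.exists_segment u
  by_cases h : eventInstant G W ε y k < ENNReal.ofReal u ∨ k = 0
  · rw [fwdFlowLeft_eq_of_segment h h2.le, fwdFlow_eq_of_segment h1 h2]
  · have hk : 0 < k := Nat.pos_of_ne_zero fun h0 => h (Or.inr h0)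
    have heq : eventInstant G W ε y k = ENNReal.ofReal u := le_antisymm h1 (not_lt.1 fun hlt => h (Or.inl hlt))
    obtain ⟨-, hjump⟩ := hgood.exists_jump hG hGρ hy ⟨hu, k, hk, heq⟩
    rw [hjump, eventJump_apply_fst]

/-- The left-continuous forward flow of a forward-good datum stays in the confined domain. [folklore] -/
theorem fwdFlowLeft_mem (hG : G.IsHardSphereRegular ε) (hGρ : G.IsHardSphereRegular ρ)
    (hy : y ∈ confinedDomain G (Wall.balls G ctr ρ hρ) N ε)
    (hgood : FwdGood G (Wall.balls G ctr ρ hρ) ε y) {u : ℝ} (hu : 0 ≤ u) :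
    fwdFlowLeft G (Wall.balls G ctr ρ hρ) ε y u ∈ confinedDomain G (Wall.balls G ctr ρ hρ) N ε := by
  have hfst := hgood.fwdFlowLeft_apply_fst hG hGρ hy hu
  have hm := hgood.fwdFlow_mem hu
  refine ⟨(mem_hardSphereDomain_congr_fst hfst).2 hm.1, fun i k => ?_⟩
  rw [hfst]
  exact hm.2 i k

omit [Finite ι] in
/-- **Pair contacts happen only at instants** (left-continuous flow): a pair contact at a time
`u ≥ 0`, incoming if `u = 0`, forces `u ∈ instantSet`. [folklore] -/
theorem mem_instantSet_of_fwdFlowLeft_mem_contactSet (hG : G.IsHardSphereRegular ε)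
    (hgood : FwdGood G (Wall.balls G ctr ρ hρ) ε y) {u : ℝ} (hu : 0 ≤ u) {i j : Fin N} (hij : i ≠ j)
    (hc : fwdFlowLeft G (Wall.balls G ctr ρ hρ) ε y u ∈ contactSet G N ε i j)
    (h0 : u = 0 → IsIncoming G (fwdFlowLeft G (Wall.balls G ctr ρ hρ) ε y u) i j) :
    u ∈ instantSet G (Wall.balls G ctr ρ hρ) ε y := by
  set W := Wall.balls G ctr ρ hρ
  rcases hu.eq_or_lt with rfl | hu'
  · have hL : fwdFlowLeft G W ε y 0 = y := by rw [fwdFlowLeft_of_nonpos le_rfl, freeFlight_zero]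
    rw [hL] at hc h0
    refine ⟨le_rfl, 1, one_pos, ?_⟩
    rw [eventInstant_one, ENNReal.ofReal_zero, exitTime_eq_zero_of_isIncoming hG hij hc (h0 rfl)]
  · obtain ⟨k, h1, h2⟩ := hgood.exists_segment_left hu'
    rcases h2.lt_or_eq with hlt | heq
    · exfalso
      rw [fwdFlowLeft_eq_of_segment (Or.inl h1) h2] at hc
      refine (hgood.2.1 k _ (sub_pos.2 (ENNReal.toReal_lt_of_lt_ofReal h1)) ?_).1 i j hij hc
      rw [eventInstant_succ] at hlt
      exact Alexander.ofReal_sub_toReal_lt hu h1.le hlt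
    · exact ⟨hu, k + 1, Nat.succ_pos k, heq.symm⟩

omit [Finite ι] in
/-- **Wall contacts happen only at instants** (left-continuous flow): a wall contact at a time
`u ≥ 0`, wall-incoming if `u = 0`, forces `u ∈ instantSet`. [folklore] -/
theorem mem_instantSet_of_fwdFlowLeft_mem_contact (hGρ : G.IsHardSphereRegular ρ)
    (hgood : FwdGood G (Wall.balls G ctr ρ hρ) ε y) {u : ℝ} (hu : 0 ≤ u) {i : Fin N} {k' : ι}
    (hc : (fwdFlowLeft G (Wall.balls G ctr ρ hρ) ε y u i).1 ∈ (Wall.balls G ctr ρ hρ k').contact)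
    (h0 : u = 0 → IsWallIncoming (Wall.balls G ctr ρ hρ k') (fwdFlowLeft G (Wall.balls G ctr ρ hρ) ε y u) i) :
    u ∈ instantSet G (Wall.balls G ctr ρ hρ) ε y := by
  set W := Wall.balls G ctr ρ hρ
  rcases hu.eq_or_lt with rfl | hu'
  · have hL : fwdFlowLeft G W ε y 0 = y := by rw [fwdFlowLeft_of_nonpos le_rfl, freeFlight_zero]
    rw [hL] at hc h0
    refine ⟨le_rfl, 1, one_pos, ?_⟩
    rw [eventInstant_one, ENNReal.ofReal_zero, exitTime_eq_zero_of_isWallIncoming hGρ hc (h0 rfl)]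
  · obtain ⟨k, h1, h2⟩ := hgood.exists_segment_left hu'
    rcases h2.lt_or_eq with hlt | heq
    · exfalso
      rw [fwdFlowLeft_eq_of_segment (Or.inl h1) h2] at hc
      refine (hgood.2.1 k _ (sub_pos.2 (ENNReal.toReal_lt_of_lt_ofReal h1)) ?_).2 i k' hc
      rw [eventInstant_succ] at hlt
      exact Alexander.ofReal_sub_toReal_lt hu h1.le hlt
    · exact ⟨hu, k + 1, Nat.succ_pos k, heq.symm⟩

/-- At an instant the forward flow carries a contact: a pair contact or a wall contact. [folklore] -/
theorem exists_contact_fwdFlow (hG : G.IsHardSphereRegular ε) (hGρ : G.IsHardSphereRegular ρ)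
    (hy : y ∈ confinedDomain G (Wall.balls G ctr ρ hρ) N ε)
    (hgood : FwdGood G (Wall.balls G ctr ρ hρ) ε y) {u : ℝ}
    (hu : u ∈ instantSet G (Wall.balls G ctr ρ hρ) ε y) :
    (∃ p : Fin N × Fin N, p.1 ≠ p.2 ∧ fwdFlow G (Wall.balls G ctr ρ hρ) ε y u ∈ contactSet G N ε p.1 p.2) ∨
      ∃ q : Fin N × ι, (fwdFlow G (Wall.balls G ctr ρ hρ) ε y u q.1).1 ∈ (Wall.balls G ctr ρ hρ q.2).contact := by
  obtain ⟨hev, hjump⟩ := hgood.exists_jump hG hGρ hy hu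
  rcases hev.exists_eventJump_eq with ⟨p, hp, -⟩ | ⟨q, hq, -⟩
  · refine Or.inl ⟨p, hp.1.ne, ?_⟩
    rw [hjump]
    exact eventJump_mem_contactSet_iff.2 hp.1.mem_contactSet
  · refine Or.inr ⟨q, ?_⟩
    rw [hjump, eventJump_apply_fst]
    exact hq.mem_contact

/-! ## One-sided limits of the forward flow -/

omit [Finite ι] in
/-- The forward flow is right-continuous. [folklore] -/
theorem tendsto_fwdFlow_nhdsGT (hG : G.IsHardSphereRegular ε) {W : ι → Wall d X} (hgood : FwdGood G W ε y)
    (u : ℝ) : Tendsto (fwdFlow G W ε y) (𝓝[>] u) (𝓝 (fwdFlow G W ε y u)) := by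
  obtain ⟨k, h1, h2⟩ := hgood.exists_segment u
  have hev : ∀ᶠ w in 𝓝[>] u, fwdFlow G W ε y w =
      freeFlight G (w - (eventInstant G W ε y k).toReal) (stateAfter G W ε y k) := by
    have hopen : ∀ᶠ w in 𝓝 u, ENNReal.ofReal w < eventInstant G W ε y (k + 1) :=
      (isOpen_Iio.preimage ENNReal.continuous_ofReal).mem_nhds h2
    filter_upwards [mem_nhdsWithin_of_mem_nhds hopen, self_mem_nhdsWithin] with w hw1 hw2
    exact fwdFlow_eq_of_segment (h1.trans (ENNReal.ofReal_le_ofReal (le_of_lt hw2))) hw1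
  have hc : Continuous fun w : ℝ => freeFlight G (w - (eventInstant G W ε y k).toReal) (stateAfter G W ε y k) := by
    have h := hG.continuous_freeFlight (N := N) (stateAfter G W ε y k)
    fun_prop
  rw [fwdFlow_eq_of_segment h1 h2]
  exact ((hc.tendsto u).mono_left nhdsWithin_le_nhds).congr' (hev.mono fun w hw => hw.symm)

omit [Finite ι] in
/-- The forward flow has left limits, given by the left-continuous forward flow. [folklore] -/
theorem tendsto_fwdFlow_nhdsLT (hG : G.IsHardSphereRegular ε) {W : ι → Wall d X} (hgood : FwdGood G W ε y)
    {u : ℝ} (hu : 0 < u) : Tendsto (fwdFlow G W ε y) (𝓝[<] u) (𝓝 (fwdFlowLeft G W ε y u)) := by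
  obtain ⟨k, h1, h2⟩ := hgood.exists_segment_left hu
  have hev : ∀ᶠ w in 𝓝[<] u, fwdFlow G W ε y w =
      freeFlight G (w - (eventInstant G W ε y k).toReal) (stateAfter G W ε y k) := by
    have hopen : ∀ᶠ w in 𝓝 u, eventInstant G W ε y k < ENNReal.ofReal w :=
      (isOpen_Ioi.preimage ENNReal.continuous_ofReal).mem_nhds h1
    filter_upwards [mem_nhdsWithin_of_mem_nhds hopen, self_mem_nhdsWithin] with w hw1 hw2
    exact fwdFlow_eq_of_segment hw1.le (((ENNReal.ofReal_lt_ofReal_iff hu).2 hw2).trans_le h2)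
  have hc : Continuous fun w : ℝ => freeFlight G (w - (eventInstant G W ε y k).toReal) (stateAfter G W ε y k) := by
    have h := hG.continuous_freeFlight (N := N) (stateAfter G W ε y k)
    fun_prop
  rw [fwdFlowLeft_eq_of_segment (Or.inl h1) h2]
  exact ((hc.tendsto u).mono_left nhdsWithin_le_nhds).congr' (hev.mono fun w hw => hw.symm)

omit [Finite ι] in
/-- The left-continuous forward flow is left-continuous. [folklore] -/
theorem tendsto_fwdFlowLeft_nhdsLT (hG : G.IsHardSphereRegular ε) {W : ι → Wall d X}
    (hgood : FwdGood G W ε y) {u : ℝ} (hu : 0 < u) :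
    Tendsto (fwdFlowLeft G W ε y) (𝓝[<] u) (𝓝 (fwdFlowLeft G W ε y u)) := by
  obtain ⟨k, h1, h2⟩ := hgood.exists_segment_left hu
  have hev : ∀ᶠ w in 𝓝[<] u, fwdFlowLeft G W ε y w =
      freeFlight G (w - (eventInstant G W ε y k).toReal) (stateAfter G W ε y k) := by
    have hopen : ∀ᶠ w in 𝓝 u, eventInstant G W ε y k < ENNReal.ofReal w :=
      (isOpen_Ioi.preimage ENNReal.continuous_ofReal).mem_nhds h1
    filter_upwards [mem_nhdsWithin_of_mem_nhds hopen, self_mem_nhdsWithin] with w hw1 hw2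
    exact fwdFlowLeft_eq_of_segment (Or.inl hw1) (((ENNReal.ofReal_lt_ofReal_iff hu).2 hw2).le.trans h2)
  have hc : Continuous fun w : ℝ => freeFlight G (w - (eventInstant G W ε y k).toReal) (stateAfter G W ε y k) := by
    have h := hG.continuous_freeFlight (N := N) (stateAfter G W ε y k)
    fun_prop
  rw [fwdFlowLeft_eq_of_segment (Or.inl h1) h2]
  exact ((hc.tendsto u).mono_left nhdsWithin_le_nhds).congr' (hev.mono fun w hw => hw.symm)

omit [Finite ι] in
/-- The left-continuous forward flow has right limits, given by the forward flow. [folklore] -/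
theorem tendsto_fwdFlowLeft_nhdsGT (hG : G.IsHardSphereRegular ε) {W : ι → Wall d X}
    (hgood : FwdGood G W ε y) {u : ℝ} (hu : 0 ≤ u) :
    Tendsto (fwdFlowLeft G W ε y) (𝓝[>] u) (𝓝 (fwdFlow G W ε y u)) := by
  obtain ⟨k, h1, h2⟩ := hgood.exists_segment u
  have hev : ∀ᶠ w in 𝓝[>] u, fwdFlowLeft G W ε y w =
      freeFlight G (w - (eventInstant G W ε y k).toReal) (stateAfter G W ε y k) := by
    have hopen : ∀ᶠ w in 𝓝 u, ENNReal.ofReal w < eventInstant G W ε y (k + 1) :=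
      (isOpen_Iio.preimage ENNReal.continuous_ofReal).mem_nhds h2
    filter_upwards [mem_nhdsWithin_of_mem_nhds hopen, self_mem_nhdsWithin] with w hw1 hw2
    have hw2' : ENNReal.ofReal u < ENNReal.ofReal w := (ENNReal.ofReal_lt_ofReal_iff (hu.trans_lt hw2)).2 hw2
    exact fwdFlowLeft_eq_of_segment (Or.inl (h1.trans_lt hw2')) hw1.le
  have hc : Continuous fun w : ℝ => freeFlight G (w - (eventInstant G W ε y k).toReal) (stateAfter G W ε y k) := by
    have h := hG.continuous_freeFlight (N := N) (stateAfter G W ε y k)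
    fun_prop
  rw [fwdFlow_eq_of_segment h1 h2]
  exact ((hc.tendsto u).mono_left nhdsWithin_le_nhds).congr' (hev.mono fun w hw => hw.symm)

end Regular

end FwdGood

/-! ## Orbits of good points are confined hard-sphere trajectories -/

section Good

variable [TopologicalSpace X] [Finite ι] {z : Config N d X}

/-- A good datum has a positive exit time (its contacts are outgoing). [folklore] -/
theorem exitTime_pos_of_mem_good (hG : G.IsHardSphereRegular ε) (hGρ : G.IsHardSphereRegular ρ)
    (hz : z ∈ good G (Wall.balls G ctr ρ hρ) ε) : 0 < exitTime G (Wall.balls G ctr ρ hρ) ε z :=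
  exitTime_pos hG hGρ hz.1 (fun i j hij hc hin => lt_asymm hin (hz.2.1 i j hij hc).1)
    (fun i k hc hin => lt_asymm hin (hz.2.2.1 i k hc).1)

/-- `T⁰ z = z` on the good set. [folklore] -/
theorem flow_zero_of_mem_good (hG : G.IsHardSphereRegular ε) (hGρ : G.IsHardSphereRegular ρ)
    (hz : z ∈ good G (Wall.balls G ctr ρ hρ) ε) : flow G (Wall.balls G ctr ρ hρ) ε 0 z = z :=
  flow_zero_of_pos (exitTime_pos_of_mem_good hG hGρ hz)

/-- For `t ≤ 0` (including `t = 0`) the flow of a good datum is the flipped left-continuous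
forward flow of the flipped datum. [folklore] -/
theorem flow_of_nonpos (hG : G.IsHardSphereRegular ε) (hGρ : G.IsHardSphereRegular ρ)
    (hz : z ∈ good G (Wall.balls G ctr ρ hρ) ε) {t : ℝ} (ht : t ≤ 0) :
    flow G (Wall.balls G ctr ρ hρ) ε t z =
      flipVel (fwdFlowLeft G (Wall.balls G ctr ρ hρ) ε (flipVel z) (-t)) := by
  rcases ht.lt_or_eq with ht' | rfl
  · exact flow_of_neg ht' z
  · rw [flow_zero_of_mem_good hG hGρ hz, neg_zero, fwdFlowLeft_of_nonpos le_rfl, freeFlight_zero,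
      flipVel_flipVel]

/-- The positive event times of the orbit of a good datum are the forward instants. [folklore] -/
theorem mem_eventTimes_flow_iff_of_pos (hG : G.IsHardSphereRegular ε) (hGρ : G.IsHardSphereRegular ρ)
    (hz : z ∈ good G (Wall.balls G ctr ρ hρ) ε) {t : ℝ} (ht : 0 < t) :
    t ∈ eventTimes G (Wall.balls G ctr ρ hρ) ε (fun s => flow G (Wall.balls G ctr ρ hρ) ε s z) ↔
      t ∈ instantSet G (Wall.balls G ctr ρ hρ) ε z := by
  rw [mem_eventTimes, mem_collisionTimes, mem_wallCollisionTimes]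
  simp only [flow_of_nonneg ht.le, mem_wallContactSet]
  constructor
  · rintro (⟨i, j, hij, hc⟩ | ⟨i, k, -, hc⟩)
    · exact hz.2.2.2.1.mem_instantSet_of_fwdFlow_mem_contactSet ht hij hc
    · exact hz.2.2.2.1.mem_instantSet_of_fwdFlow_mem_contact ht hc
  · intro h
    rcases hz.2.2.2.1.exists_contact_fwdFlow hG hGρ hz.1 h with ⟨p, hp, hc⟩ | ⟨q, hc⟩
    · exact Or.inl ⟨p.1, p.2, hp, hc⟩
    · exact Or.inr ⟨q.1, q.2, hz.2.2.2.1.fwdFlow_mem ht.le, hc⟩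

/-- The nonpositive event times of the orbit of a good datum are the negatives of the forward
instants of the flipped datum. [folklore] -/
theorem mem_eventTimes_flow_iff_of_nonpos (hG : G.IsHardSphereRegular ε) (hGρ : G.IsHardSphereRegular ρ)
    (hz : z ∈ good G (Wall.balls G ctr ρ hρ) ε) {t : ℝ} (ht : t ≤ 0) :
    t ∈ eventTimes G (Wall.balls G ctr ρ hρ) ε (fun s => flow G (Wall.balls G ctr ρ hρ) ε s z) ↔
      -t ∈ instantSet G (Wall.balls G ctr ρ hρ) ε (flipVel z) := by
  have hzf : flipVel z ∈ confinedDomain G (Wall.balls G ctr ρ hρ) N ε := flipVel_mem_confinedDomain_iff.2 hz.1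
  rw [mem_eventTimes, mem_collisionTimes, mem_wallCollisionTimes]
  simp only [flow_of_nonpos hG hGρ hz ht, flipVel_mem_contactSet_iff, mem_wallContactSet,
    flipVel_mem_confinedDomain_iff, flipVel_apply]
  constructor
  · rintro (⟨i, j, hij, hc⟩ | ⟨i, k, -, hc⟩)
    · refine hz.2.2.2.2.mem_instantSet_of_fwdFlowLeft_mem_contactSet hG (neg_nonneg.2 ht) hij hc fun h0 => ?_
      have ht0 : t = 0 := by linarith
      subst ht0
      rw [neg_zero, fwdFlowLeft_of_nonpos le_rfl, freeFlight_zero] at hc ⊢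
      exact (isIncoming_flipVel_iff z i j).2 (hz.2.1 i j hij hc).1
    · refine hz.2.2.2.2.mem_instantSet_of_fwdFlowLeft_mem_contact hGρ (neg_nonneg.2 ht) hc fun h0 => ?_
      have ht0 : t = 0 := by linarith
      subst ht0
      rw [neg_zero, fwdFlowLeft_of_nonpos le_rfl, freeFlight_zero] at hc ⊢
      exact (isWallIncoming_flipVel_iff _ z i).2 (hz.2.2.1 i k hc).1
  · intro h
    obtain ⟨hev, -⟩ := hz.2.2.2.2.exists_jump hG hGρ hzf h
    rcases hev.exists_eventJump_eq with ⟨p, hp, -⟩ | ⟨q, hq, -⟩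
    · exact Or.inl ⟨p.1, p.2, hp.1.ne, hp.1.mem_contactSet⟩
    · exact Or.inr ⟨q.1, q.2, hz.2.2.2.2.fwdFlowLeft_mem hG hGρ hzf (neg_nonneg.2 ht), hq.mem_contact⟩

/-- The event times of the orbit of a good datum are locally finite. [folklore] -/
theorem finite_eventTimes_flow_inter_Icc (hG : G.IsHardSphereRegular ε) (hGρ : G.IsHardSphereRegular ρ)
    (hz : z ∈ good G (Wall.balls G ctr ρ hρ) ε) (a b : ℝ) :
    (eventTimes G (Wall.balls G ctr ρ hρ) ε (fun s => flow G (Wall.balls G ctr ρ hρ) ε s z) ∩ Icc a b).Finite := by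
  refine ((hz.2.2.2.1.finite_instantSet_inter_Iic b).union
    ((hz.2.2.2.2.finite_instantSet_inter_Iic (-a)).image fun u => -u)).subset ?_
  rintro t ⟨ht, hta, htb⟩
  rcases lt_or_ge 0 t with h0 | h0
  · exact Or.inl ⟨(mem_eventTimes_flow_iff_of_pos hG hGρ hz h0).1 ht, htb⟩
  · refine Or.inr ⟨-t, ⟨(mem_eventTimes_flow_iff_of_nonpos hG hGρ hz h0).1 ht, ?_⟩, neg_neg t⟩
    exact neg_le_neg hta

omit [Finite ι] in
/-- The orbit of a good datum is right-continuous at nonnegative times. [folklore] -/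
theorem tendsto_flow_nhdsGT_of_nonneg (hG : G.IsHardSphereRegular ε)
    (hz : z ∈ good G (Wall.balls G ctr ρ hρ) ε) {t : ℝ} (ht : 0 ≤ t) :
    Tendsto (fun s => flow G (Wall.balls G ctr ρ hρ) ε s z) (𝓝[>] t)
      (𝓝 (flow G (Wall.balls G ctr ρ hρ) ε t z)) := by
  have hev : ∀ᶠ s in 𝓝[>] t, fwdFlow G (Wall.balls G ctr ρ hρ) ε z s = flow G (Wall.balls G ctr ρ hρ) ε s z := by
    filter_upwards [self_mem_nhdsWithin] with s hs
    exact (flow_of_nonneg (ht.trans (le_of_lt hs)) z).symm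
  rw [flow_of_nonneg ht]
  exact (hz.2.2.2.1.tendsto_fwdFlow_nhdsGT hG t).congr' hev

omit [Finite ι] in
/-- The orbit of a good datum has left limit `Φ_{t⁻}` at positive times. [folklore] -/
theorem tendsto_flow_nhdsLT_of_pos (hG : G.IsHardSphereRegular ε)
    (hz : z ∈ good G (Wall.balls G ctr ρ hρ) ε) {t : ℝ} (ht : 0 < t) :
    Tendsto (fun s => flow G (Wall.balls G ctr ρ hρ) ε s z) (𝓝[<] t)
      (𝓝 (fwdFlowLeft G (Wall.balls G ctr ρ hρ) ε z t)) := by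
  have hev : ∀ᶠ s in 𝓝[<] t, fwdFlow G (Wall.balls G ctr ρ hρ) ε z s = flow G (Wall.balls G ctr ρ hρ) ε s z := by
    filter_upwards [mem_nhdsWithin_of_mem_nhds (Ioi_mem_nhds ht)] with s hs
    exact (flow_of_nonneg (le_of_lt hs) z).symm
  exact (hz.2.2.2.1.tendsto_fwdFlow_nhdsLT hG ht).congr' hev

omit [Finite ι] in
/-- The orbit of a good datum has left limits at nonpositive times, given by the flipped forward
flow of the flipped datum. [folklore] -/
theorem tendsto_flow_nhdsLT_of_nonpos (hG : G.IsHardSphereRegular ε)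
    (hz : z ∈ good G (Wall.balls G ctr ρ hρ) ε) {t : ℝ} (ht : t ≤ 0) :
    Tendsto (fun s => flow G (Wall.balls G ctr ρ hρ) ε s z) (𝓝[<] t)
      (𝓝 (flipVel (fwdFlow G (Wall.balls G ctr ρ hρ) ε (flipVel z) (-t)))) := by
  set W := Wall.balls G ctr ρ hρ
  have hev : ∀ᶠ s in 𝓝[<] t, flipVel (fwdFlowLeft G W ε (flipVel z) (-s)) = flow G W ε s z := by
    filter_upwards [self_mem_nhdsWithin] with s hs
    exact (flow_of_neg (lt_of_lt_of_le hs ht) z).symm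
  have h1 : Tendsto (fun s : ℝ => -s) (𝓝[<] t) (𝓝[>] (-t)) := tendsto_neg_nhdsLT
  have h2 := (hz.2.2.2.2.tendsto_fwdFlowLeft_nhdsGT hG (neg_nonneg.2 ht)).comp h1
  have h3 : Tendsto (fun s : ℝ => flipVel (fwdFlowLeft G W ε (flipVel z) (-s))) (𝓝[<] t)
      (𝓝 (flipVel (fwdFlow G W ε (flipVel z) (-t)))) :=
    (continuous_flipVel.tendsto _).comp h2
  exact h3.congr' hev

omit [Finite ι] in
/-- The orbit of a good datum is right-continuous at negative times. [folklore] -/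
theorem tendsto_flow_nhdsGT_of_neg (hG : G.IsHardSphereRegular ε)
    (hz : z ∈ good G (Wall.balls G ctr ρ hρ) ε) {t : ℝ} (ht : t < 0) :
    Tendsto (fun s => flow G (Wall.balls G ctr ρ hρ) ε s z) (𝓝[>] t)
      (𝓝 (flow G (Wall.balls G ctr ρ hρ) ε t z)) := by
  set W := Wall.balls G ctr ρ hρ
  have hev : ∀ᶠ s in 𝓝[>] t, flipVel (fwdFlowLeft G W ε (flipVel z) (-s)) = flow G W ε s z := by
    filter_upwards [mem_nhdsWithin_of_mem_nhds (Iio_mem_nhds ht)] with s hs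
    exact (flow_of_neg hs z).symm
  have h1 : Tendsto (fun s : ℝ => -s) (𝓝[>] t) (𝓝[<] (-t)) := tendsto_neg_nhdsGT
  have h2 := (hz.2.2.2.2.tendsto_fwdFlowLeft_nhdsLT hG (neg_pos.2 ht)).comp h1
  have h3 : Tendsto (fun s : ℝ => flipVel (fwdFlowLeft G W ε (flipVel z) (-s))) (𝓝[>] t)
      (𝓝 (flipVel (fwdFlowLeft G W ε (flipVel z) (-t)))) :=
    (continuous_flipVel.tendsto _).comp h2
  rw [flow_of_neg ht]
  exact h3.congr' hev

/-- Positions along the orbit of a good datum are continuous. [folklore] -/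
theorem continuous_flow_apply_fst (hG : G.IsHardSphereRegular ε) (hGρ : G.IsHardSphereRegular ρ)
    (hz : z ∈ good G (Wall.balls G ctr ρ hρ) ε) (i : Fin N) :
    Continuous fun s => (flow G (Wall.balls G ctr ρ hρ) ε s z i).1 := by
  set W := Wall.balls G ctr ρ hρ
  have hzf : flipVel z ∈ confinedDomain G W N ε := flipVel_mem_confinedDomain_iff.2 hz.1
  have hπ : Continuous fun c : Config N d X => (c i).1 := by fun_prop
  rw [continuous_iff_continuousAt]
  intro t
  rw [continuousAt_iff_continuous_left'_right']
  constructor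
  · rcases lt_or_ge 0 t with ht | ht
    · have h := (hπ.tendsto _).comp (tendsto_flow_nhdsLT_of_pos hG hz ht)
      have hval : (fwdFlowLeft G W ε z t i).1 = (flow G W ε t z i).1 := by
        rw [flow_of_nonneg ht.le, hz.2.2.2.1.fwdFlowLeft_apply_fst hG hGρ hz.1 ht.le]
      rw [hval] at h
      exact h
    · have h := (hπ.tendsto _).comp (tendsto_flow_nhdsLT_of_nonpos hG hz ht)
      have hval : (flipVel (fwdFlow G W ε (flipVel z) (-t)) i).1 = (flow G W ε t z i).1 := by
        rw [flow_of_nonpos hG hGρ hz ht, flipVel_apply, flipVel_apply]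
        exact (hz.2.2.2.2.fwdFlowLeft_apply_fst hG hGρ hzf (neg_nonneg.2 ht) i).symm
      rw [hval] at h
      exact h
  · rcases lt_or_ge t 0 with ht | ht
    · exact (hπ.tendsto _).comp (tendsto_flow_nhdsGT_of_neg hG hz ht)
    · exact (hπ.tendsto _).comp (tendsto_flow_nhdsGT_of_nonneg hG hz ht)

/-- Free flight on event-free windows `(s, t]` with `0 ≤ s`. [folklore] -/
theorem flow_free_of_nonneg (hG : G.IsHardSphereRegular ε) (hGρ : G.IsHardSphereRegular ρ)
    (hz : z ∈ good G (Wall.balls G ctr ρ hρ) ε) {s t : ℝ} (hs : 0 ≤ s) (hst : s ≤ t)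
    (hfree : ∀ σ ∈ Ioc s t, σ ∉ eventTimes G (Wall.balls G ctr ρ hρ) ε
      (fun u => flow G (Wall.balls G ctr ρ hρ) ε u z)) :
    flow G (Wall.balls G ctr ρ hρ) ε t z = freeFlight G (t - s) (flow G (Wall.balls G ctr ρ hρ) ε s z) := by
  rw [flow_of_nonneg hs, flow_of_nonneg (hs.trans hst)]
  refine hz.2.2.2.1.fwdFlow_eq_freeFlight_fwdFlow hs hst fun u hu huI => ?_
  exact hfree u huI ((mem_eventTimes_flow_iff_of_pos hG hGρ hz (hs.trans_lt huI.1)).2 hu)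

/-- Free flight on event-free windows `(s, t]` with `t ≤ 0`. [folklore] -/
theorem flow_free_of_nonpos (hG : G.IsHardSphereRegular ε) (hGρ : G.IsHardSphereRegular ρ)
    (hz : z ∈ good G (Wall.balls G ctr ρ hρ) ε) {s t : ℝ} (ht : t ≤ 0) (hst : s ≤ t)
    (hfree : ∀ σ ∈ Ioc s t, σ ∉ eventTimes G (Wall.balls G ctr ρ hρ) ε
      (fun u => flow G (Wall.balls G ctr ρ hρ) ε u z)) :
    flow G (Wall.balls G ctr ρ hρ) ε t z = freeFlight G (t - s) (flow G (Wall.balls G ctr ρ hρ) ε s z) := by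
  rw [flow_of_nonpos hG hGρ hz ht, flow_of_nonpos hG hGρ hz (hst.trans ht)]
  have h := hz.2.2.2.2.fwdFlowLeft_eq_freeFlight_fwdFlowLeft (a := -t) (b := -s)
    (neg_nonneg.2 ht) (neg_le_neg hst) fun u hu huI => ?_
  · rw [h, show -s - -t = t - s by ring, freeFlight_flipVel_freeFlight]
  · refine hfree (-u) ⟨by linarith [huI.2], by linarith [huI.1]⟩ ?_
    refine (mem_eventTimes_flow_iff_of_nonpos hG hGρ hz (by linarith [huI.1])).2 ?_
    rw [neg_neg]
    exact hu

/-- **Free flight on event-free windows** for the orbit of a good datum. [folklore] -/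
theorem flow_free (hG : G.IsHardSphereRegular ε) (hGρ : G.IsHardSphereRegular ρ)
    (hz : z ∈ good G (Wall.balls G ctr ρ hρ) ε) {s t : ℝ} (hst : s ≤ t)
    (hfree : ∀ σ ∈ Ioc s t, σ ∉ eventTimes G (Wall.balls G ctr ρ hρ) ε
      (fun u => flow G (Wall.balls G ctr ρ hρ) ε u z)) :
    flow G (Wall.balls G ctr ρ hρ) ε t z = freeFlight G (t - s) (flow G (Wall.balls G ctr ρ hρ) ε s z) := by
  rcases le_or_gt 0 s with hs | hs
  · exact flow_free_of_nonneg hG hGρ hz hs hst hfree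
  rcases le_or_gt t 0 with ht | ht
  · exact flow_free_of_nonpos hG hGρ hz ht hst hfree
  · have h1 := flow_free_of_nonneg hG hGρ hz le_rfl ht.le fun σ hσ => hfree σ ⟨hs.trans hσ.1, hσ.2⟩
    have h2 := flow_free_of_nonpos hG hGρ hz le_rfl hs.le fun σ hσ => hfree σ ⟨hσ.1, hσ.2.trans ht.le⟩
    rw [h1, h2, ← freeFlight_add]
    congr 1
    ring

/-- **Pair collisions along the orbit of a good datum are simple**: a single contact pair, no
sphere on a wall, an incoming left limit, and the elastic jump. [folklore] -/
theorem flow_binary (hG : G.IsHardSphereRegular ε) (hGρ : G.IsHardSphereRegular ρ)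
    (hz : z ∈ good G (Wall.balls G ctr ρ hρ) ε) (t : ℝ) (i j : Fin N) (hij : i ≠ j)
    (hc : flow G (Wall.balls G ctr ρ hρ) ε t z ∈ contactSet G N ε i j) :
    (∀ i' j' : Fin N, i' ≠ j' → flow G (Wall.balls G ctr ρ hρ) ε t z ∈ contactSet G N ε i' j' →
      ({i', j'} : Finset (Fin N)) = {i, j}) ∧
    (∀ (i' : Fin N) (k : ι), (flow G (Wall.balls G ctr ρ hρ) ε t z i').1 ∉ (Wall.balls G ctr ρ hρ k).contact) ∧
    ∃ zl, Tendsto (fun s => flow G (Wall.balls G ctr ρ hρ) ε s z) (𝓝[<] t) (𝓝 zl) ∧ IsIncoming G zl i j ∧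
      flow G (Wall.balls G ctr ρ hρ) ε t z = collidePair G i j zl := by
  set W := Wall.balls G ctr ρ hρ
  have hzf : flipVel z ∈ confinedDomain G W N ε := flipVel_mem_confinedDomain_iff.2 hz.1
  rcases lt_or_ge 0 t with ht | ht
  · have hI : t ∈ instantSet G W ε z :=
      (mem_eventTimes_flow_iff_of_pos hG hGρ hz ht).1 (Or.inl ⟨i, j, hij, hc⟩)
    obtain ⟨hev, hjump⟩ := hz.2.2.2.1.exists_jump hG hGρ hz.1 hI
    rw [flow_of_nonneg ht.le] at hc ⊢
    have hfst : ∀ k, (fwdFlow G W ε z t k).1 = (fwdFlowLeft G W ε z t k).1 := fun k => by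
      rw [hjump, eventJump_apply_fst]
    have hcL : fwdFlowLeft G W ε z t ∈ contactSet G N ε i j := (mem_contactSet_congr_fst hfst).1 hc
    rcases hev.exists_eventJump_eq with ⟨p, hp, hpeq⟩ | ⟨q, hq, -⟩
    · refine ⟨fun i' j' hij' hc' => ?_, fun i' k hc' => ?_, fwdFlowLeft G W ε z t,
        tendsto_flow_nhdsLT_of_pos hG hz ht, hp.1.isIncoming_of_mem_contactSet hG hij hcL, ?_⟩
      · rw [(hp.1.2.2 i' j' hij').1 ((mem_contactSet_congr_fst hfst).1 hc'), (hp.1.2.2 i j hij).1 hcL]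
      · rw [hfst] at hc'
        exact hp.2 i' k hc'
      · rw [hjump, hpeq, hp.1.collidePair_eq hG (fun _ => rfl) hij hcL]
    · exact (hq.not_mem_contactSet hij hcL).elim
  · have hI : -t ∈ instantSet G W ε (flipVel z) :=
      (mem_eventTimes_flow_iff_of_nonpos hG hGρ hz ht).1 (Or.inl ⟨i, j, hij, hc⟩)
    obtain ⟨hev, hjump⟩ := hz.2.2.2.2.exists_jump hG hGρ hzf hI
    rw [flow_of_nonpos hG hGρ hz ht] at hc ⊢
    have hcL : fwdFlowLeft G W ε (flipVel z) (-t) ∈ contactSet G N ε i j := (flipVel_mem_contactSet_iff _).1 hc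
    rcases hev.exists_eventJump_eq with ⟨p, hp, hpeq⟩ | ⟨q, hq, -⟩
    · refine ⟨fun i' j' hij' hc' => ?_, fun i' k hc' => ?_, flipVel (fwdFlow G W ε (flipVel z) (-t)),
        tendsto_flow_nhdsLT_of_nonpos hG hz ht, ?_, ?_⟩
      · rw [(hp.1.2.2 i' j' hij').1 ((flipVel_mem_contactSet_iff _).1 hc'), (hp.1.2.2 i j hij).1 hcL]
      · rw [flipVel_apply] at hc'
        exact hp.2 i' k hc'
      · rw [isIncoming_flipVel_iff, hjump, hpeq]
        exact hp.1.isOutgoing_collidePair hG hij hcL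
      · rw [collidePair_flipVel hij, hjump, hpeq,
          hp.1.collidePair_eq hG (fun k => collidePair_apply_fst _ k) hij hcL, collidePair_collidePair hp.1.ne]
    · exact (hq.not_mem_contactSet hij hcL).elim

/-- **Wall reflections along the orbit of a good datum are simple**: a single sphere on a single
wall, no pair in contact, a wall-incoming left limit, and the specular jump. [folklore] -/
theorem flow_wall (hG : G.IsHardSphereRegular ε) (hGρ : G.IsHardSphereRegular ρ)
    (hz : z ∈ good G (Wall.balls G ctr ρ hρ) ε) (t : ℝ) (i : Fin N) (k : ι)
    (hc : (flow G (Wall.balls G ctr ρ hρ) ε t z i).1 ∈ (Wall.balls G ctr ρ hρ k).contact) :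
    (∀ (i' : Fin N) (k' : ι), (flow G (Wall.balls G ctr ρ hρ) ε t z i').1 ∈ (Wall.balls G ctr ρ hρ k').contact →
      i' = i ∧ k' = k) ∧
    (∀ i' j' : Fin N, i' ≠ j' → flow G (Wall.balls G ctr ρ hρ) ε t z ∉ contactSet G N ε i' j') ∧
    ∃ zl, Tendsto (fun s => flow G (Wall.balls G ctr ρ hρ) ε s z) (𝓝[<] t) (𝓝 zl) ∧
      IsWallIncoming (Wall.balls G ctr ρ hρ k) zl i ∧
      flow G (Wall.balls G ctr ρ hρ) ε t z = reflectWall (Wall.balls G ctr ρ hρ k) i zl := by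
  set W := Wall.balls G ctr ρ hρ
  have hzf : flipVel z ∈ confinedDomain G W N ε := flipVel_mem_confinedDomain_iff.2 hz.1
  rcases lt_or_ge 0 t with ht | ht
  · have hmem : flow G W ε t z ∈ confinedDomain G W N ε := by
      rw [flow_of_nonneg ht.le]; exact hz.2.2.2.1.fwdFlow_mem ht.le
    have hI : t ∈ instantSet G W ε z :=
      (mem_eventTimes_flow_iff_of_pos hG hGρ hz ht).1 (Or.inr ⟨i, k, hmem, hc⟩)
    obtain ⟨hev, hjump⟩ := hz.2.2.2.1.exists_jump hG hGρ hz.1 hI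
    rw [flow_of_nonneg ht.le] at hc ⊢
    have hfst : ∀ k, (fwdFlow G W ε z t k).1 = (fwdFlowLeft G W ε z t k).1 := fun k => by
      rw [hjump, eventJump_apply_fst]
    have hcL : (fwdFlowLeft G W ε z t i).1 ∈ (W k).contact := by rw [← hfst]; exact hc
    rcases hev.exists_eventJump_eq with ⟨p, hp, -⟩ | ⟨q, hq, hqeq⟩
    · exact (hp.2 i k hcL).elim
    · obtain ⟨rfl, rfl⟩ := hq.eq_of_mem_contact hcL
      refine ⟨fun i' k' hc' => ?_, fun i' j' hij' hc' => ?_, fwdFlowLeft G W ε z t,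
        tendsto_flow_nhdsLT_of_pos hG hz ht, hq.isWallIncoming, ?_⟩
      · rw [hfst] at hc'
        exact hq.eq_of_mem_contact hc'
      · exact hq.not_mem_contactSet hij' ((mem_contactSet_congr_fst hfst).1 hc')
      · rw [hjump, hqeq]
  · have hmem : flow G W ε t z ∈ confinedDomain G W N ε := by
      rw [flow_of_nonpos hG hGρ hz ht, flipVel_mem_confinedDomain_iff]
      exact hz.2.2.2.2.fwdFlowLeft_mem hG hGρ hzf (neg_nonneg.2 ht)
    have hI : -t ∈ instantSet G W ε (flipVel z) :=
      (mem_eventTimes_flow_iff_of_nonpos hG hGρ hz ht).1 (Or.inr ⟨i, k, hmem, hc⟩)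
    obtain ⟨hev, hjump⟩ := hz.2.2.2.2.exists_jump hG hGρ hzf hI
    rw [flow_of_nonpos hG hGρ hz ht] at hc ⊢
    rw [flipVel_apply] at hc
    rcases hev.exists_eventJump_eq with ⟨p, hp, -⟩ | ⟨q, hq, hqeq⟩
    · exact (hp.2 i k hc).elim
    · obtain ⟨rfl, rfl⟩ := hq.eq_of_mem_contact hc
      refine ⟨fun i' k' hc' => ?_, fun i' j' hij' hc' => ?_, flipVel (fwdFlow G W ε (flipVel z) (-t)),
        tendsto_flow_nhdsLT_of_nonpos hG hz ht, ?_, ?_⟩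
      · rw [flipVel_apply] at hc'
        exact hq.eq_of_mem_contact hc'
      · exact hq.not_mem_contactSet hij' ((flipVel_mem_contactSet_iff _).1 hc')
      · rw [isWallIncoming_flipVel_iff, hjump, hqeq]
        exact hq.isWallOutgoing_reflectWall
      · rw [reflectWall_flipVel, hjump, hqeq, reflectWall_reflectWall]

/-- **Orbits of good points are confined hard-sphere trajectories** (CIP 1994 §4.2 p. 65,
Thm. 4.2.1), for the event-by-event flow `ConfinedAlexander.flow` among round scatterers of any
geometry regular at `ε` and `ρ`: `t ↦ T^t z` stays confined, has locally finitely many event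
times, continuous positions, is free flight between events and resolves each event by the
elastic reflection of a single incoming pair or the specular reflection of a single
wall-incoming sphere at a single scatterer. [cite: CIP1994, §4.2 p. 65] -/
theorem isConfinedHardSphereTrajectory_flow (hG : G.IsHardSphereRegular ε) (hGρ : G.IsHardSphereRegular ρ)
    (hz : z ∈ good G (Wall.balls G ctr ρ hρ) ε) :
    IsConfinedHardSphereTrajectory G (Wall.balls G ctr ρ hρ) ε N fun t => flow G (Wall.balls G ctr ρ hρ) ε t z where
  mem t := by
    show flow G (Wall.balls G ctr ρ hρ) ε t z ∈ confinedDomain G (Wall.balls G ctr ρ hρ) N ε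
    rcases le_or_gt 0 t with ht | ht
    · rw [flow_of_nonneg ht]
      exact hz.2.2.2.1.fwdFlow_mem ht
    · rw [flow_of_neg ht, flipVel_mem_confinedDomain_iff]
      exact hz.2.2.2.2.fwdFlowLeft_mem hG hGρ (flipVel_mem_confinedDomain_iff.2 hz.1) (neg_nonneg.2 ht.le)
  locFinite a b := finite_eventTimes_flow_inter_Icc hG hGρ hz a b
  pos_continuous i := continuous_flow_apply_fst hG hGρ hz i
  free s t hst hfree := flow_free hG hGρ hz hst hfree
  binary t i j hij hc := flow_binary hG hGρ hz t i j hij hc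
  wall t i k hc := flow_wall hG hGρ hz t i k hc

end Good

/-- **Orbits of good points are confined hard-sphere trajectories on the flat torus among round
scatterers**, `0 < ε < 1/2`, `0 < ρ < 1/2` (a geometry regular at both radii,
`Torus.isHardSphereRegular_geometry`; CIP 1994 §4.2 p. 65). [cite: CIP1994, §4.2 p. 65] -/
theorem isConfinedHardSphereTrajectory_flow_torus [Finite ι] {ε ρ : ℝ} (hε' : ε < 2⁻¹) (hρ : 0 < ρ)
    (hρ' : ρ < 2⁻¹) (ctr : ι → UnitAddTorus d) {z : Config N d (UnitAddTorus d)}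
    (hz : z ∈ good (Torus.geometry d) (Wall.balls (Torus.geometry d) ctr ρ hρ) ε) :
    IsConfinedHardSphereTrajectory (Torus.geometry d) (Wall.balls (Torus.geometry d) ctr ρ hρ) ε N
      fun t => flow (Torus.geometry d) (Wall.balls (Torus.geometry d) ctr ρ hρ) ε t z :=
  isConfinedHardSphereTrajectory_flow (Torus.isHardSphereRegular_geometry hε')
    (Torus.isHardSphereRegular_geometry hρ') hz

end ConfinedAlexander

end Kinetic

end

end Literature.Analysis.FluidPDE
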